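import Literature.NumberTheory.GaloisRepresentations.InflationKernelCoefficientChange
import Literature.NumberTheory.GaloisRepresentations.LocalKummerTorsion
import Literature.NumberTheory.GaloisRepresentations.AbsGaloisGroupCompact
import Literature.NumberTheory.IwasawaTheory.Greenberg2006.TwistDeformationLEO
import HarnessLib

/-!
# `H²`-inflation along `H ↠ Gal(K_S/F) = galoisGroupAbove S H`, descent of `μ_N`, and the
# transgression cocycle on `N_S`

Plumbing for the restricted-ramification quotient INSIDE `Γ_K` (tree `RestrictedRamification`,
`Greenberg2006.galoisGroupAbove`): `S` a set of finite places of `K`, `N_S = ramificationSubgroup K S`,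
`H ≤ Γ_K` with `N_S ≤ H` (`F := K̄^H ⊆ K_S`), `q : H ↠ galoisGroupAbove S H = H/N_S = Gal(K_S/F)`,
`σ ↦ σ N_S`; coefficients `μ_N = mu K N` DESCENDED to `Gal(K_S/F)` (a continuous representation `ρG` of
`galoisGroupAbove S H` on `MuCarrier K N` with `ρG(q σ) = σ`).

* §1 `coe_mem_galoisGroupAbove`, `galoisGroupAbove_mk_mul`, `…_mk_eq_one_iff` (`q σ = 1 ↔ σ ∈ N_S`),
  `…_mk_surjective`; `exists_twoCocycle_inflate` (every `2`-cocycle `f` of `Gal(K_S/F)` in `μ_N` has the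
  inflated cocycle `f ∘ (q × q)` on `H`); `exists_inflation₂` — **the inflation
  `H²(Gal(K_S/F), μ_N) →+ H²(H, μ_N)` exists and is computed on cocycles by composition with `q × q`**
  (Mathlib functoriality; the degree-`2` companion of the cell's degree-`1` `UnramifiedInflation`);
* §2 `exists_continuousRep_galoisGroupAbove_mu` — `μ_N` descends to `G_{K,S}` (hence to every
  `Gal(K_S/F)`) as soon as `N_S` acts trivially on it (e.g. `S ⊇ {v ∣ N}`);
* §3 `exists_transgression_oneCocycle` — for `f ∘ (q × q) = ∂φ` on `H`, the transgression datum
  `x(n) = φ(n) − f(1,1)` is a continuous `1`-cocycle `N_S → μ_N` (tree `transgression_mul`,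
  `InflationKernelCoefficientChange.lean`).

Consumed by `RestrictedRamificationInflationKernel.lean` (`ker(inf²)` dies under `μ_N ↪ μ_{N'}` from
radical descent + Kummer theory over `K_S` — the `Cl_S`-step of cyclotomic weak Leopoldt, NSW (8.3.11),
(10.3.25)).  HONEST FRAMING: cochain plumbing; nothing arithmetic is asserted here.

## References

* J. Neukirch, A. Schmidt, K. Wingberg, *Cohomology of Number Fields*, 2nd ed. (2008), (1.5.1), (1.6.6)–(1.6.7),
  VIII §3. [NeukirchSchmidtWingberg2008]
* J.-P. Serre, *Galois Cohomology* (1997), I §2.1, I §2.6. [SerreGaloisCohomology1997]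
* R. Greenberg, *On the structure of certain Galois cohomology groups*, Doc. Math. Extra Vol. Coates (2006),
  p. 342 (`H^i(K_Σ/K_∞, ·)`). [Greenberg2006]
-/

noncomputable section

open CategoryTheory Function Topology Field NumberField IsDedekindDomain

namespace Literature.NumberTheory.GaloisRepresentations

open _root_.TopRep _root_.ContRepresentation _root_.ContinuousCohomology DiscreteGaloisModule
open Literature.NumberTheory.IwasawaTheory.Greenberg2006

variable {K : Type} [Field K] [NumberField K] (S : Set (HeightOneSpectrum (𝓞 K)))
  (H : Subgroup (absoluteGaloisGroup K))

/-! ### §1. The quotient map `q : H ↠ Gal(K_S/F) = galoisGroupAbove S H` and the `H²`-inflation along it -/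

omit [NumberField K] in
/-- The class `σ̄ = σ N_S ∈ Gal(K_S/F)` of `σ ∈ H` lies in `galoisGroupAbove S H`. [cite: Greenberg2006, p. 342] -/
theorem coe_mem_galoisGroupAbove (σ : H) :
    toUnramifiedQuot K S (σ : absoluteGaloisGroup K) ∈ galoisGroupAbove S H :=
  Subgroup.mem_map_of_mem _ σ.2

omit [NumberField K] in
/-- `q : H → galoisGroupAbove S H`, `σ ↦ σ N_S`, is multiplicative (plumbing for `Gal(K_S/F) = H/N_S`).
[cite: NeukirchSchmidtWingberg2008, VIII §3] [cite: Greenberg2006, p. 342] -/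
theorem galoisGroupAbove_mk_mul (σ τ : H) :
    (⟨toUnramifiedQuot K S ((σ * τ : H) : absoluteGaloisGroup K), coe_mem_galoisGroupAbove S H (σ * τ)⟩ :
        galoisGroupAbove S H) =
      ⟨toUnramifiedQuot K S (σ : absoluteGaloisGroup K), coe_mem_galoisGroupAbove S H σ⟩ *
        ⟨toUnramifiedQuot K S (τ : absoluteGaloisGroup K), coe_mem_galoisGroupAbove S H τ⟩ :=
  Subtype.ext (by simp)

omit [NumberField K] in
/-- `q σ = 1 ↔ σ ∈ N_S` (the kernel of `H ↠ Gal(K_S/F)` is `Gal(K̄/K_S) = N_S`).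
[cite: NeukirchSchmidtWingberg2008, VIII §3] -/
theorem galoisGroupAbove_mk_eq_one_iff (σ : H) :
    (⟨toUnramifiedQuot K S (σ : absoluteGaloisGroup K), coe_mem_galoisGroupAbove S H σ⟩ :
        galoisGroupAbove S H) = 1 ↔ (σ : absoluteGaloisGroup K) ∈ ramificationSubgroup K S := by
  rw [← QuotientGroup.eq_one_iff]
  exact ⟨fun h => congrArg Subtype.val h, fun h => Subtype.ext h⟩

omit [NumberField K] in
/-- `q : H ↠ Gal(K_S/F)` is onto. [cite: NeukirchSchmidtWingberg2008, VIII §3] [cite: Greenberg2006, p. 342] -/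
theorem galoisGroupAbove_mk_surjective :
    Surjective fun σ : H => (⟨toUnramifiedQuot K S (σ : absoluteGaloisGroup K), coe_mem_galoisGroupAbove S H σ⟩ :
      galoisGroupAbove S H) := fun g => by
  obtain ⟨σ, hσH, hσ⟩ := (mem_galoisGroupAbove_iff S H g).1 g.2
  exact ⟨⟨σ, hσH⟩, Subtype.ext hσ⟩

variable {N : ℕ}

omit [NumberField K] in
/-- **Every `2`-cocycle of `Gal(K_S/F)` in `μ_N` inflates to a `2`-cocycle of `H`** (its composite with
`q × q`), for any descended action `ρG` (`ρG(σ̄) = σ` on `μ_N`). [cite: SerreGaloisCohomology1997, I §2.6] -/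
theorem exists_twoCocycle_inflate (ρG : ContinuousRep (galoisGroupAbove S H) ℤ (MuCarrier K N))
    (hρG : ∀ (σ : H) (v : MuCarrier K N),
      ρG ⟨toUnramifiedQuot K S (σ : absoluteGaloisGroup K), coe_mem_galoisGroupAbove S H σ⟩ v =
        mu K N (σ : absoluteGaloisGroup K) v)
    (f : contTwoCocycles ρG.toTopRep) :
    ∃ F : contTwoCocycles ((mu K N).restrict (subgroupIncl H)).toTopRep,
      ∀ σ τ : H, F.1 (σ, τ) =
        f.1 (⟨toUnramifiedQuot K S (σ : absoluteGaloisGroup K), coe_mem_galoisGroupAbove S H σ⟩,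
          ⟨toUnramifiedQuot K S (τ : absoluteGaloisGroup K), coe_mem_galoisGroupAbove S H τ⟩) := by
  have hqc : Continuous fun σ : H =>
      (⟨toUnramifiedQuot K S (σ : absoluteGaloisGroup K), coe_mem_galoisGroupAbove S H σ⟩ : galoisGroupAbove S H) :=
    ((continuous_toUnramifiedQuot K S).comp continuous_subtype_val).subtype_mk _
  refine ⟨⟨f.1.comp ⟨_, hqc.prodMap hqc⟩, fun σ τ υ => ?_⟩, fun σ τ => rfl⟩
  change ((mu K N).restrict (subgroupIncl H)) σ (f.1 (_, _)) + f.1 (_, _) = f.1 (_, _) + f.1 (_, _)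
  rw [ContinuousRep.restrict_apply, subgroupIncl_apply, ← hρG σ]
  have h := f.2 ⟨toUnramifiedQuot K S (σ : absoluteGaloisGroup K), coe_mem_galoisGroupAbove S H σ⟩
    ⟨toUnramifiedQuot K S (τ : absoluteGaloisGroup K), coe_mem_galoisGroupAbove S H τ⟩
    ⟨toUnramifiedQuot K S (υ : absoluteGaloisGroup K), coe_mem_galoisGroupAbove S H υ⟩
  rw [ContinuousRep.toTopRep_ρ_apply, ← galoisGroupAbove_mk_mul, ← galoisGroupAbove_mk_mul] at h
  exact h

/-- **The inflation `inf : H²(Gal(K_S/F), μ_N) →+ H²(H, μ_N)` exists** (Mathlib's functoriality of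
continuous cohomology along `q : H → Gal(K_S/F)` with the identity of `μ_N`) and is computed on
inhomogeneous `2`-cocycles by composition with `q × q`; `H` closed (so that `H` and `Gal(K_S/F)` are
compact and `H²` is described by continuous cocycles). [cite: SerreGaloisCohomology1997, I §2.6]
[cite: NeukirchSchmidtWingberg2008, (1.5.1), (1.6.7)] -/
theorem exists_inflation₂ (hH : IsClosed (H : Set (absoluteGaloisGroup K)))
    (ρG : ContinuousRep (galoisGroupAbove S H) ℤ (MuCarrier K N))
    (hρG : ∀ (σ : H) (v : MuCarrier K N),
      ρG ⟨toUnramifiedQuot K S (σ : absoluteGaloisGroup K), coe_mem_galoisGroupAbove S H σ⟩ v =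
        mu K N (σ : absoluteGaloisGroup K) v) :
    haveI : CompactSpace (galoisGroupAbove S H) := compactSpace_galoisGroupAbove S H hH
    ∃ infl : (continuousCohomology 2 ρG.toTopRep : Type) →+
        (continuousCohomology 2 ((mu K N).restrict (subgroupIncl H)).toTopRep : Type),
      ∀ (f : contTwoCocycles ρG.toTopRep) (F : contTwoCocycles ((mu K N).restrict (subgroupIncl H)).toTopRep),
        (∀ σ τ : H, F.1 (σ, τ) =
          f.1 (⟨toUnramifiedQuot K S (σ : absoluteGaloisGroup K), coe_mem_galoisGroupAbove S H σ⟩,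
            ⟨toUnramifiedQuot K S (τ : absoluteGaloisGroup K), coe_mem_galoisGroupAbove S H τ⟩)) →
        infl (twoCocycleClass _ f) = twoCocycleClass _ F := by
  haveI : CompactSpace (absoluteGaloisGroup K) := absoluteGaloisGroup_compactSpace K
  haveI : CompactSpace H := isCompact_iff_compactSpace.mp hH.isCompact
  haveI : CompactSpace (galoisGroupAbove S H) := compactSpace_galoisGroupAbove S H hH
  let θ : H →ₜ* galoisGroupAbove S H :=
    { toFun := fun σ => ⟨toUnramifiedQuot K S (σ : absoluteGaloisGroup K), coe_mem_galoisGroupAbove S H σ⟩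
      map_one' := Subtype.ext (by simp)
      map_mul' := fun a b => galoisGroupAbove_mk_mul S H a b
      continuous_toFun := ((continuous_toUnramifiedQuot K S).comp continuous_subtype_val).subtype_mk _ }
  let ι₀ : TopRep.res (θ : H →* galoisGroupAbove S H) ρG.toTopRep ⟶ ((mu K N).restrict (subgroupIncl H)).toTopRep :=
    TopRep.ofHom ⟨ContinuousLinearMap.id ℤ (MuCarrier K N), fun σ => by
      ext v
      change ρG (θ σ) v = (mu K N).restrict (subgroupIncl H) σ v
      rw [ContinuousRep.restrict_apply, subgroupIncl_apply]
      exact hρG σ v⟩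
  refine ⟨(ContinuousCohomology.map θ ι₀ 2).hom.toLinearMap.toAddMonoidHom, fun f F hF => ?_⟩
  change ContinuousCohomology.map θ ι₀ 2 (twoCocycleClass _ f) = twoCocycleClass _ F
  rw [map_twoCocycleClass]
  exact congrArg _ (Subtype.ext (ContinuousMap.ext fun x => (hF x.1 x.2).symm))

/-! ### §2. Descent of `μ_N` to `Gal(K_S/F)` -/

omit [NumberField K] in
/-- **`μ_N` descends to `G_{K,S}` when `N_S` acts trivially on it** (e.g. `S ⊇ {v ∣ N}`): there is a
continuous representation `ρ₀` of `G_{K,S} = Γ_K ⧸ N_S` on `MuCarrier K N` with `ρ₀(σ̄) = σ`; its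
restriction to `galoisGroupAbove S H` is a descended action `ρG` as used below (the stabilisers in the
quotient are the images of the open stabilisers in `Γ_K` under the open map `Γ_K → G_{K,S}`).
[cite: NeukirchSchmidtWingberg2008, VIII §3] [cite: SerreGaloisCohomology1997, I §2.1] -/
theorem exists_continuousRep_galoisGroupAbove_mu
    (htriv : ∀ n ∈ ramificationSubgroup K S, ∀ v : MuCarrier K N, mu K N n v = v) :
    ∃ ρ₀ : ContinuousRep (GaloisGroupUnramifiedOutside K S) ℤ (MuCarrier K N),
      (∀ (σ : absoluteGaloisGroup K) (v : MuCarrier K N), ρ₀ (toUnramifiedQuot K S σ) v = mu K N σ v) ∧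
      ∀ (σ : H) (v : MuCarrier K N),
        ρ₀.restrict (subgroupIncl (galoisGroupAbove S H))
            ⟨toUnramifiedQuot K S (σ : absoluteGaloisGroup K), coe_mem_galoisGroupAbove S H σ⟩ v =
          mu K N (σ : absoluteGaloisGroup K) v := by
  let r : Representation ℤ (absoluteGaloisGroup K) (MuCarrier K N) := (mu K N).toRepresentation
  have hker : ∀ n ∈ ramificationSubgroup K S, r n = 1 := fun n hn => by
    ext v
    exact htriv n hn v
  let r₀ : Representation ℤ (GaloisGroupUnramifiedOutside K S) (MuCarrier K N) :=
    QuotientGroup.lift (ramificationSubgroup K S) r fun n hn => hker n hn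
  have hr₀ : ∀ (σ : absoluteGaloisGroup K) (v : MuCarrier K N), r₀ (toUnramifiedQuot K S σ) v = mu K N σ v :=
    fun σ v => by
      change (QuotientGroup.lift (ramificationSubgroup K S) r _ (QuotientGroup.mk σ)) v = mu K N σ v
      rw [QuotientGroup.lift_mk]
      rfl
  have hρ₀ : ∃ ρ₀ : ContinuousRep (GaloisGroupUnramifiedOutside K S) ℤ (MuCarrier K N),
      ∀ (σ : absoluteGaloisGroup K) (v : MuCarrier K N), ρ₀ (toUnramifiedQuot K S σ) v = mu K N σ v := by
    refine ⟨ContinuousRep.ofStabilizerMemNhdsOne r₀ fun v => ?_, hr₀⟩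
    have hopen : IsOpen {σ : absoluteGaloisGroup K | mu K N σ v = v} := (mu K N).isOpen_setOf_apply_eq v
    have himg : toUnramifiedQuot K S '' {σ : absoluteGaloisGroup K | mu K N σ v = v} ⊆
        {g : GaloisGroupUnramifiedOutside K S | r₀ g v = v} := by
      rintro _ ⟨σ, hσ, rfl⟩
      change r₀ (toUnramifiedQuot K S σ) v = v
      rw [hr₀]; exact hσ
    refine Filter.mem_of_superset ((isOpenMap_toUnramifiedQuot K S _ hopen).mem_nhds ⟨1, ?_, map_one _⟩) himg
    change mu K N 1 v = v
    rw [map_one]; rfl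
  obtain ⟨ρ₀, hρ₀⟩ := hρ₀
  exact ⟨ρ₀, hρ₀, fun σ v => by rw [ContinuousRep.restrict_apply, subgroupIncl_apply]; exact hρ₀ _ v⟩

/-! ### §3. The transgression datum and the main theorem -/

omit [NumberField K] in
/-- **The transgression datum is a continuous `1`-cocycle of `N_S` in `μ_N`**: for a `2`-cocycle `f`
of `Gal(K_S/F)` with `f ∘ (q × q) = ∂φ` on `H`, `x(n) = φ(n) − f(1,1)` (`n ∈ N_S ≤ H`) is a continuous
crossed homomorphism `N_S → μ_N` (indeed a homomorphism, `N_S` acting trivially).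
[cite: NeukirchSchmidtWingberg2008, (1.6.6)–(1.6.7)] -/
theorem exists_transgression_oneCocycle (hNH : ramificationSubgroup K S ≤ H)
    (ρG : ContinuousRep (galoisGroupAbove S H) ℤ (MuCarrier K N))
    (hρG : ∀ (σ : H) (v : MuCarrier K N),
      ρG ⟨toUnramifiedQuot K S (σ : absoluteGaloisGroup K), coe_mem_galoisGroupAbove S H σ⟩ v =
        mu K N (σ : absoluteGaloisGroup K) v)
    (f : contTwoCocycles ρG.toTopRep) (φ : C(H, MuCarrier K N))
    (hφ : ∀ σ τ : H,
      f.1 (⟨toUnramifiedQuot K S (σ : absoluteGaloisGroup K), coe_mem_galoisGroupAbove S H σ⟩,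
          ⟨toUnramifiedQuot K S (τ : absoluteGaloisGroup K), coe_mem_galoisGroupAbove S H τ⟩) =
        mu K N (σ : absoluteGaloisGroup K) (φ τ) - φ (σ * τ) + φ σ) :
    ∃ x : contOneCocycles ((mu K N).restrict (subgroupIncl (ramificationSubgroup K S))).toTopRep,
      ∀ n : ramificationSubgroup K S, x.1 n = φ ⟨(n : absoluteGaloisGroup K), hNH n.2⟩ - f.1 (1, 1) := by
  -- the quotient map as a continuous homomorphism, and (3a)'s hypothesis shape
  let θ : H →ₜ* galoisGroupAbove S H :=
    { toFun := fun σ => ⟨toUnramifiedQuot K S (σ : absoluteGaloisGroup K), coe_mem_galoisGroupAbove S H σ⟩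
      map_one' := Subtype.ext (by simp)
      map_mul' := fun a b => galoisGroupAbove_mk_mul S H a b
      continuous_toFun := ((continuous_toUnramifiedQuot K S).comp continuous_subtype_val).subtype_mk _ }
  have hφ' : ∀ σ τ : H, f.1 (θ σ, θ τ) = ρG.toTopRep.ρ (θ σ) (φ τ) - φ (σ * τ) + φ σ := fun σ τ => by
    rw [ContinuousRep.toTopRep_ρ_apply]
    change _ = ρG ⟨toUnramifiedQuot K S (σ : absoluteGaloisGroup K), coe_mem_galoisGroupAbove S H σ⟩ (φ τ) - _ + _
    rw [hρG]
    exact hφ σ τ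
  have hθN : ∀ n : ramificationSubgroup K S, θ ⟨(n : absoluteGaloisGroup K), hNH n.2⟩ = 1 := fun n =>
    (galoisGroupAbove_mk_eq_one_iff S H _).2 n.2
  refine ⟨⟨⟨fun n => φ ⟨(n : absoluteGaloisGroup K), hNH n.2⟩ - f.1 (1, 1),
    (φ.continuous.comp (continuous_inclusion hNH)).sub continuous_const⟩, fun n n' => ?_⟩, fun n => rfl⟩
  change φ ⟨((n * n' : ramificationSubgroup K S) : absoluteGaloisGroup K), _⟩ - f.1 (1, 1) =
    (φ ⟨(n : absoluteGaloisGroup K), hNH n.2⟩ - f.1 (1, 1)) +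
      ((mu K N).restrict (subgroupIncl (ramificationSubgroup K S))) n
        (φ ⟨(n' : absoluteGaloisGroup K), hNH n'.2⟩ - f.1 (1, 1))
  have hmul : (⟨((n * n' : ramificationSubgroup K S) : absoluteGaloisGroup K), hNH (n * n').2⟩ : H) =
      ⟨(n : absoluteGaloisGroup K), hNH n.2⟩ * ⟨(n' : absoluteGaloisGroup K), hNH n'.2⟩ := Subtype.ext rfl
  rw [hmul, transgression_mul θ f φ hφ' (hθN n) (hθN n'), ContinuousRep.restrict_apply, subgroupIncl_apply]
  -- `N_S` acts trivially on `μ_N` (it does so through `ρG` at `q n' … = 1`)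
  congr 1
  have h := hρG ⟨(n : absoluteGaloisGroup K), hNH n.2⟩ (φ ⟨(n' : absoluteGaloisGroup K), hNH n'.2⟩ - f.1 (1, 1))
  rw [show (⟨toUnramifiedQuot K S ((⟨(n : absoluteGaloisGroup K), hNH n.2⟩ : H) : absoluteGaloisGroup K),
      coe_mem_galoisGroupAbove S H _⟩ : galoisGroupAbove S H) = 1 from hθN n, map_one] at h
  exact h

end Literature.NumberTheory.GaloisRepresentations

end
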